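import Literature.MathematicalPhysics.QuantumLattice.GrassmannPolchinskiEquation
import Literature.MathematicalPhysics.QuantumLattice.GrassmannKernels
import Mathlib.Analysis.Calculus.MeanValue
import HarnessLib

/-!
# Duhamel / mean-value bound for the pinned `L¹` kernel norms along a differentiable curve in the Grassmann algebra

Topic `MathematicalPhysics/QuantumLattice`; companion of `GrassmannPolchinskiEquation` (coefficientwise derivatives `HasCoeffDerivAt`,
Salmhofer's RGE `hasCoeffDerivAt_effAction_flow`) and `GrassmannKernels` (the kernels `kernel 𝕜 F m X`).  Salmhofer 1998, §3.1–§4.1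
integrates the RGE in `t` and bounds the kernels of `𝒢(t) − 𝒢(0)` by the time integral of the kernel norms of the right side; on a finite
algebra this is the mean-value inequality applied to the kernels, one output leg pinned and the others summed:

* `hasDerivAt_kernel_of_hasCoeffDerivAt` — kernels of a coefficientwise differentiable curve are differentiable, with derivative the kernel of the derivative
  (the kernel is the linear functional `(m!)⁻¹ • [∂_X ·]_∅`);
* `re_sum_conj_mul_le_sum_norm`, `sum_norm_eq_re_sum_conj_phase_mul` — `ℓ¹` duality: `Re Σ_Y conj(u Y)·a Y ≤ Σ_Y ‖a Y‖` for `‖u Y‖ ≤ 1`, with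
  equality for the phases `u Y = a Y/‖a Y‖`;
* **`sum_norm_kernel_sub_le_of_hasCoeffDerivAt`** — if `s ↦ X s` has coefficientwise derivative `X′ s` at every `s ∈ [0,1]` and the pinned
  kernel sums of `X′ s` in degree `m` are `≤ B` there, then `Σ_{Y : Y_i = w} ‖kernel (X 1) m Y − kernel (X 0) m Y‖ ≤ B` (scalar mean-value
  theorem for `s ↦ Re Σ_Y conj(u Y)·kernel (X s) m Y`, then duality).

With `hasCoeffDerivAt_effAction_flow` along `s ↦ C₀ + s•D` this bounds the kernels of `effAction (C₀ + D) V − effAction C₀ V` by the pinned kernel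
norms of `Δ_D 𝒱_s − ½(δ𝒱_s, D δ𝒱_s)`, uniformly in `s` (the far half of the defect step of a nested two-volume comparison).
Everything is proved; no definition, no named fact.

## Sources
M. Salmhofer, Commun. Math. Phys. 194 (1998) 249–295, §3.1 Prop. 1, §4.1 (integration of the RGE) [`Salmhofer1998`];
M. Salmhofer, *Renormalization: An Introduction* (Springer 1999), §4.3–§4.4 [`Salmhofer1999`].
-/

noncomputable section

namespace Literature.MathematicalPhysics.QuantumLattice

open GrassmannAlgebra Finset
open scoped ComplexConjugate

section Duality

variable {𝕜 : Type*} [RCLike 𝕜] {ι : Type*}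

/-- `Re Σ_Y conj(u Y)·a Y ≤ Σ_Y ‖a Y‖` whenever `‖u Y‖ ≤ 1`. [cite: Salmhofer1998, §4.1] -/
theorem re_sum_conj_mul_le_sum_norm (s : Finset ι) (u a : ι → 𝕜) (hu : ∀ Y, ‖u Y‖ ≤ 1) :
    RCLike.re (∑ Y ∈ s, conj (u Y) * a Y) ≤ ∑ Y ∈ s, ‖a Y‖ := by
  rw [map_sum]
  refine sum_le_sum fun Y _ => ?_
  calc RCLike.re (conj (u Y) * a Y) ≤ ‖conj (u Y) * a Y‖ := RCLike.re_le_norm _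
    _ = ‖u Y‖ * ‖a Y‖ := by rw [norm_mul, RCLike.norm_conj]
    _ ≤ 1 * ‖a Y‖ := mul_le_mul_of_nonneg_right (hu Y) (norm_nonneg _)
    _ = ‖a Y‖ := one_mul _

/-- With the phases `u Y = a Y / ‖a Y‖` (norm `≤ 1`), `Re Σ_Y conj(u Y)·a Y = Σ_Y ‖a Y‖`. [cite: Salmhofer1998, §4.1] -/
theorem sum_norm_eq_re_sum_conj_phase_mul (s : Finset ι) (a : ι → 𝕜) :
    (∑ Y ∈ s, ‖a Y‖ : ℝ) = RCLike.re (∑ Y ∈ s, conj (a Y / (‖a Y‖ : 𝕜)) * a Y) := by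
  rw [map_sum]
  refine sum_congr rfl fun Y _ => ?_
  by_cases h : a Y = 0
  · simp [h]
  · have hn : (‖a Y‖ : 𝕜) ≠ 0 := by exact_mod_cast (norm_ne_zero_iff.2 h)
    rw [map_div₀, RCLike.conj_ofReal, div_mul_eq_mul_div, RCLike.conj_mul, ← RCLike.ofReal_pow,
      ← RCLike.ofReal_div, RCLike.ofReal_re, pow_two, mul_div_assoc, div_self (norm_ne_zero_iff.2 h), mul_one]

/-- The phases have norm `≤ 1`. [cite: Salmhofer1998, §4.1] -/
theorem norm_phase_le_one (a : 𝕜) : ‖a / (‖a‖ : 𝕜)‖ ≤ 1 := by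
  by_cases h : a = 0
  · simp [h]
  · rw [norm_div, RCLike.norm_ofReal, abs_norm, div_self (norm_ne_zero_iff.2 h)]

end Duality

section MVT

variable {𝕜 : Type*} [RCLike 𝕜] {Γ : Type*} [LinearOrder Γ] [Fintype Γ]

/-- **Kernels of a differentiable curve are differentiable**: `∂_s kernel (X s) m Y = kernel (X′) m Y` (the kernel is the linear functional
`(m!)⁻¹ • [∂_Y ·]_∅`). [cite: Salmhofer1998, §3.1 Prop. 1 proof] -/
theorem hasDerivAt_kernel_of_hasCoeffDerivAt {X : ℝ → GrassmannAlgebra 𝕜 Γ} {X' : GrassmannAlgebra 𝕜 Γ} {t : ℝ}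
    (hX : HasCoeffDerivAt X X' t) (m : ℕ) (Y : Fin m → Γ) :
    HasDerivAt (fun r => kernel 𝕜 (X r) m Y) (kernel 𝕜 X' m Y) t := by
  set lam : GrassmannAlgebra 𝕜 Γ →ₗ[𝕜] 𝕜 :=
    (((m.factorial : ℚ)⁻¹ • (1 : 𝕜)) : 𝕜) • ((constPart 𝕜 : GrassmannAlgebra 𝕜 Γ →ₐ[𝕜] 𝕜).toLinearMap ∘ₗ iterDeriv 𝕜 Y)
    with hlam
  have hlamF : ∀ F, lam F = kernel 𝕜 F m Y := fun F => by
    simp only [hlam, LinearMap.smul_apply, LinearMap.coe_comp, Function.comp_apply, AlgHom.toLinearMap_apply, kernel_def]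
    rfl
  have h := hX.apply lam
  simp only [hlamF] at h
  exact h

/-- **MEAN-VALUE BOUND FOR THE PINNED KERNEL SUMS ALONG A CURVE.**  If `s ↦ X s` has coefficientwise derivative `X′ s` at every `s ∈ [0,1]`
and `Σ_{Y : Y_i = w} ‖kernel (X′ s) m Y‖ ≤ B` for all `s ∈ [0,1]`, then `Σ_{Y : Y_i = w} ‖kernel (X 1) m Y − kernel (X 0) m Y‖ ≤ B`.
[cite: Salmhofer1998, §4.1 (integration of the RGE)] -/
theorem sum_norm_kernel_sub_le_of_hasCoeffDerivAt {X : ℝ → GrassmannAlgebra 𝕜 Γ} {X' : ℝ → GrassmannAlgebra 𝕜 Γ}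
    (hX : ∀ s ∈ Set.Icc (0 : ℝ) 1, HasCoeffDerivAt X (X' s) s) (m : ℕ) (P : Finset (Fin m → Γ)) {B : ℝ}
    (hB : ∀ s ∈ Set.Icc (0 : ℝ) 1, ∑ Y ∈ P, ‖kernel 𝕜 (X' s) m Y‖ ≤ B) :
    ∑ Y ∈ P, ‖kernel 𝕜 (X 1) m Y - kernel 𝕜 (X 0) m Y‖ ≤ B := by
  -- the phases of the difference and the scalar test function
  set a : (Fin m → Γ) → 𝕜 := fun Y => kernel 𝕜 (X 1) m Y - kernel 𝕜 (X 0) m Y with ha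
  set u : (Fin m → Γ) → 𝕜 := fun Y => a Y / (‖a Y‖ : 𝕜) with hu
  set g : ℝ → ℝ := fun s => RCLike.re (∑ Y ∈ P, conj (u Y) * kernel 𝕜 (X s) m Y) with hg
  set g' : ℝ → ℝ := fun s => RCLike.re (∑ Y ∈ P, conj (u Y) * kernel 𝕜 (X' s) m Y) with hg'
  -- `g` is differentiable with derivative `g'`
  have hderiv : ∀ s ∈ Set.Icc (0 : ℝ) 1, HasDerivWithinAt g (g' s) (Set.Icc (0 : ℝ) 1) s := by
    intro s hs
    have hsum : HasDerivAt (fun r => ∑ Y ∈ P, conj (u Y) * kernel 𝕜 (X r) m Y) (∑ Y ∈ P, conj (u Y) * kernel 𝕜 (X' s) m Y) s :=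
      HasDerivAt.fun_sum fun Y _ => (hasDerivAt_kernel_of_hasCoeffDerivAt (hX s hs) m Y).const_mul _
    have hre := (RCLike.reCLM : 𝕜 →L[ℝ] ℝ).hasFDerivAt.comp_hasDerivAt s hsum
    exact hre.hasDerivWithinAt
  have hbound : ∀ s ∈ Set.Ico (0 : ℝ) 1, ‖g' s‖ ≤ B := by
    intro s hs
    have hs' : s ∈ Set.Icc (0 : ℝ) 1 := Set.Ico_subset_Icc_self hs
    rw [hg', Real.norm_eq_abs, abs_le]
    constructor
    · -- `-B ≤ g' s` from the bound applied to `-u`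
      have h := re_sum_conj_mul_le_sum_norm P (fun Y => -u Y) (fun Y => kernel 𝕜 (X' s) m Y)
        (fun Y => by rw [norm_neg]; exact norm_phase_le_one _)
      simp only [map_neg, neg_mul, sum_neg_distrib, map_neg] at h
      linarith [hB s hs']
    · exact (re_sum_conj_mul_le_sum_norm P u (fun Y => kernel 𝕜 (X' s) m Y) fun Y => norm_phase_le_one _).trans (hB s hs')
  have hmvt := norm_image_sub_le_of_norm_deriv_le_segment_01' hderiv hbound
  -- duality: `g 1 - g 0 = Σ ‖a Y‖`
  have hdiff : g 1 - g 0 = ∑ Y ∈ P, ‖a Y‖ := by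
    rw [hg]
    simp only
    rw [← map_sub, ← sum_sub_distrib, sum_norm_eq_re_sum_conj_phase_mul P a]
    congr 1
    refine sum_congr rfl fun Y _ => ?_
    rw [← mul_sub]
  calc ∑ Y ∈ P, ‖kernel 𝕜 (X 1) m Y - kernel 𝕜 (X 0) m Y‖ = g 1 - g 0 := hdiff.symm
    _ ≤ ‖g 1 - g 0‖ := Real.le_norm_self _
    _ ≤ B := hmvt

end MVT

end Literature.MathematicalPhysics.QuantumLattice

end
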